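import Summits.BirchSwinnertonDyer.BirchSwinnertonDyer.Theorems.GenusKolyvaginAtTwoShaCardDvdPowAtTwoRTRelaxedIndexSha
import Summits.BirchSwinnertonDyer.BirchSwinnertonDyer.Theorems.GenusKolyvaginAtTwoShaCardDvdPowAtTwoRTRelaxedIndexShaTwin
import Summits.BirchSwinnertonDyer.BirchSwinnertonDyer.Theorems.GenusKolyvaginAtTwoShaCardDvdPowAtTwoRTShaFiniteAtTwoRat
import Summits.BirchSwinnertonDyer.BirchSwinnertonDyer.Theorems.GenusKolyvaginAtTwoShaCardDvdPowAtTwoRTShaFiniteAtTwoTwinShaTrivial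
import HarnessLib

/-!
# Route `GenusKolyvaginAtTwo`, crux U_T `ShaCardDvdPowAtTwoRT` (stmt-BirchSwinnertonDyer-23658), LINE 19 `rational_pair_descent`,
# stub SANDWICH′: the input `hR` of the LEAD's assembly DISCHARGED on U_T's frame — `#res⁻¹(Ш(E/K)[2^∞]) ≤ #Ш(E/ℚ)[2^∞] · 2`

Seat `bsd-line-gk2-p3` g26 (PROVER seat 3/3, cell `bsd-f1-sign2`), `--supports stmt-BirchSwinnertonDyer-23658` (helper; closes
nothing).  THEOREMS ONLY (no definition, no named fact, no `sorry`); standard axioms.  BSD is NOT proved by any of this; neither is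
U_T nor any stub.

WHY.  The LEAD's numerical closer `PlusDescent.natCard_sha_dvd_two_mul_of_inputs` (`…RTSandwichAssembly`, p749474) displays
`hR : Nat.card (res⁻¹(Ш(E/K)[2^∞])) ≤ Nat.card (Ш(E/ℚ)[2^∞]) * 2 ^ e` with `e ≤ 1`, in U_T's binder context plus `w(E) = 1` and `σ ≠ 1`.
This seat's (R) `SelmerDescent.natCard_comap_resBaseChange_shaPrimary_dvd_two_pow_onFrame` (p749677) gives
`… ∣ #Ш(E/ℚ)[2^∞] · 2^{ord₂ C(Wd)}`; with `Ш(E/ℚ)[2^∞]` FINITE on the frame (gk2-p5 g29 `finite_primaryComponent_sha_rat_two_onHabitat`) and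
PAIRCOUNT's `ord₂ C(Wd) ≤ 1`, this is `hR` with `e = 1`.

* **`natCard_comap_resBaseChange_shaPrimary_le_onHabitat`** — `hR` with `e = 1`, in the LEAD's binder order (U_T frame, `σ ≠ 1`, the
  twin `Wd` with `hWd` and `padicValNat 2 Wd.tamagawaProduct ≤ 1`; `w(E) = 1` is NOT needed for this half).
* **`natCard_comap_resBaseChange_shaPrimary_twin_le_onHabitat`** (append) — the twin side for the LEAD's (A) road:
  `#res′⁻¹(Ш(Wd/K)[2^∞]) ≤ 2` on the live configuration (`w(E) = 1`, `#Sel₂(Wd) = 2`, `ord₂ C(Wd) ≤ 1`): (R′) p749982 with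
  `#Ш(Wd/ℚ)[2^∞] = 1` (gk2-p5 g29 `natCard_primaryComponent_sha_twin_two_eq_one_onHabitat`); and both sides with the exponent symbolic
  (`…_le_two_pow_onHabitat`, `…_twin_le_two_pow_onHabitat`: `≤ #Ш(E/ℚ)[2^∞]·2^{ord₂ C(Wd)}`, `≤ 2^{ord₂ C(Wd)}`) for `e := ord₂ C(Wd)`.

References: [Kramer1981] §2 Prop. 3, Thm. 1; [MilneADT2006] I §6; [Kolyvagin1990] Thm. A.
-/

set_option autoImplicit false
set_option linter.dupNamespace false -- `Summit.<P>.<Sub>` repeats `BirchSwinnertonDyer` (D-0017)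

noncomputable section

open scoped Classical

namespace Summit.BirchSwinnertonDyer.BirchSwinnertonDyer.Theorems.GenusExact.SelmerDescent

open WeierstrassCurve NumberField IsDedekindDomain Field
open Literature.NumberTheory.EllipticCurves Literature.NumberTheory.GaloisRepresentations
open Literature.NumberTheory.EllipticCurves.ModularForms
open Summit.BirchSwinnertonDyer.BirchSwinnertonDyer.Theses.GenusKolyvaginAtTwo (KolyvaginRelationAtTwo)

/-- **The input `hR` of the SANDWICH′ assembly, discharged on U_T's frame (`e = 1`):
`#res⁻¹(Ш(E/K)[2^∞]) ≤ #Ш(E/ℚ)[2^∞] · 2`** for every elliptic model `Wd ≅ E^(d_K)` with `ord₂ C(Wd) ≤ 1` (the live configuration of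
LINE 19), `σ ≠ 1` in `Aut(K/ℚ)`.  (R) p749677 + finiteness of `Ш(E/ℚ)[2^∞]` on the frame (gk2-p5 g29) + `2^{ord₂ C(Wd)} ≤ 2`.
[cite: Kramer1981, §2 Prop. 3 and Thm. 1] [cite: Kolyvagin1990, Thm. A] [cite: MilneADT2006, I §6] -/
theorem natCard_comap_resBaseChange_shaPrimary_le_onHabitat (hQ2 : KolyvaginRelationAtTwo)
    (W : WeierstrassCurve ℚ) [W.IsElliptic] [W.IsGloballyMinimal] [NeZero (W.conductorNorm ℤ)] (hcm : ¬ W.HasCM)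
    (hT : Odd W.tamagawaProduct) (v : HeightOneSpectrum (𝓞 ℚ)) (h2v : ((2 : ℕ) : 𝓞 ℚ) ∉ v.asIdeal)
    (hNv : ((W.conductorNorm ℤ : ℕ) : 𝓞 ℚ) ∈ v.asIdeal) (hmult : W.HasMultiplicativeReductionAt v) (hneg : W.Δ < 0)
    (K : Type) [Field K] [NumberField K] (hIQ : IsImaginaryQuadratic K) (hodd : Odd (NumberField.discr K))
    (h3 : NumberField.discr K ≠ -3) (hHe : SatisfiesHeegnerHypothesis (W.conductorNorm ℤ) K)
    (hsq1 : ¬ IsSquare ((NumberField.discr K : ℚ) * -|W.Δ|)) (hsq2 : ¬ IsSquare ((NumberField.discr K : ℚ) * (-(2 * |W.Δ|))))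
    (hρ : ∀ n : ℕ, 0 < n → W.HasSurjectiveModNGaloisRep ((2 : ℤ) ^ n))
    (Dt : ModularParametrizationData W (W.conductorNorm ℤ)) (β : ℤ) (ι : K →+* ℂ) (d₁ : KolyvaginHeegnerData Dt β ι 1) (M₀ : ℕ)
    (hndiv : ¬ ∃ Q : (W.baseChange (ringClassField K ι 1)).toAffine.Point, ((2 ^ (M₀ + 1) : ℕ) : ℤ) • Q = d₁.derivedPoint)
    {σ : K ≃ₐ[ℚ] K} (hσ1 : σ ≠ 1) (Wd : WeierstrassCurve ℚ) [Wd.IsElliptic]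
    (hWd : ∃ C : VariableChange ℚ, C • W.quadraticTwist (NumberField.discr K : ℚ) = Wd)
    (hle : padicValNat 2 Wd.tamagawaProduct ≤ 1) :
    Nat.card (((AddCommGroup.primaryComponent (W.baseChange K).sha 2).map (W.baseChange K).sha.subtype).comap
        (resBaseChange W K)) ≤
      Nat.card (AddCommGroup.primaryComponent W.sha 2) * 2 ^ 1 := by
  obtain ⟨Cd, hCd⟩ := hWd
  have hdvd := natCard_comap_resBaseChange_shaPrimary_dvd_two_pow_onFrame W hIQ hσ1 hodd hHe hneg hT Cd hCd
  haveI := PlusDescent.finite_primaryComponent_sha_rat_two_onHabitat hQ2 W hcm hT v h2v hNv hmult hneg K hIQ hodd h3 hHe hsq1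
    hsq2 hρ Dt β ι d₁ M₀ hndiv
  have hpos : 0 < Nat.card (AddCommGroup.primaryComponent W.sha 2) := Nat.card_pos
  refine (Nat.le_of_dvd (Nat.mul_pos hpos (pow_pos two_pos _)) hdvd).trans ?_
  exact Nat.mul_le_mul_left _ (Nat.pow_le_pow_right two_pos hle)

/-- **The twin side for the (A) road: `#res′⁻¹(Ш(Wd/K)[2^∞]) ≤ 2` on LINE 19's live configuration** (U_T frame, `w(E) = 1`, `σ ≠ 1`,
`Wd ≅ E^(d_K)` elliptic with `#Sel₂(Wd) = 2` and `ord₂ C(Wd) ≤ 1`): (R′) `natCard_comap_resBaseChange_shaPrimary_twin_dvd_two_pow_onFrame`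
(p749982) gives `∣ #Ш(Wd/ℚ)[2^∞] · 2^{ord₂ C(Wd)}`, and `#Ш(Wd/ℚ)[2^∞] = 1` (gk2-p5 g29, `Zp = ⊥`).
[cite: Kramer1981, §2 Prop. 3 and Thm. 1] [cite: Kolyvagin1990, Thm. A] [cite: MilneADT2006, I §6] -/
theorem natCard_comap_resBaseChange_shaPrimary_twin_le_onHabitat (hQ2 : KolyvaginRelationAtTwo)
    (W : WeierstrassCurve ℚ) [W.IsElliptic] [W.IsGloballyMinimal] [NeZero (W.conductorNorm ℤ)] (hcm : ¬ W.HasCM)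
    (hT : Odd W.tamagawaProduct) (v : HeightOneSpectrum (𝓞 ℚ)) (h2v : ((2 : ℕ) : 𝓞 ℚ) ∉ v.asIdeal)
    (hNv : ((W.conductorNorm ℤ : ℕ) : 𝓞 ℚ) ∈ v.asIdeal) (hmult : W.HasMultiplicativeReductionAt v) (hneg : W.Δ < 0)
    (K : Type) [Field K] [NumberField K] (hIQ : IsImaginaryQuadratic K) (hodd : Odd (NumberField.discr K))
    (h3 : NumberField.discr K ≠ -3) (hHe : SatisfiesHeegnerHypothesis (W.conductorNorm ℤ) K)
    (hsq1 : ¬ IsSquare ((NumberField.discr K : ℚ) * -|W.Δ|)) (hsq2 : ¬ IsSquare ((NumberField.discr K : ℚ) * (-(2 * |W.Δ|))))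
    (hρ : ∀ n : ℕ, 0 < n → W.HasSurjectiveModNGaloisRep ((2 : ℤ) ^ n))
    (Dt : ModularParametrizationData W (W.conductorNorm ℤ)) (β : ℤ) (ι : K →+* ℂ) (d₁ : KolyvaginHeegnerData Dt β ι 1)
    (hnt : ¬ IsOfFinAddOrder d₁.derivedPoint) (M₀ : ℕ)
    (hndiv : ¬ ∃ Q : (W.baseChange (ringClassField K ι 1)).toAffine.Point, ((2 ^ (M₀ + 1) : ℕ) : ℤ) • Q = d₁.derivedPoint)
    (hw1 : W.rootNumber = 1) {σ : K ≃ₐ[ℚ] K} (hσ1 : σ ≠ 1) (Wd : WeierstrassCurve ℚ) [Wd.IsElliptic]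
    (hWd : ∃ C : VariableChange ℚ, C • W.quadraticTwist (NumberField.discr K : ℚ) = Wd)
    (hSel : Nat.card (Wd.selmerGroup 2) = 2) (hle : padicValNat 2 Wd.tamagawaProduct ≤ 1) :
    Nat.card (((AddCommGroup.primaryComponent (Wd.baseChange K).sha 2).map (Wd.baseChange K).sha.subtype).comap
        (resBaseChange Wd K)) ≤ 2 ^ 1 := by
  obtain ⟨Cd, hCd⟩ := hWd
  have hdvd := natCard_comap_resBaseChange_shaPrimary_twin_dvd_two_pow_onFrame W hIQ hσ1 hodd hHe hneg hT Cd hCd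
  rw [PlusDescent.natCard_primaryComponent_sha_twin_two_eq_one_onHabitat hQ2 W hcm hT v h2v hNv hmult hneg K hIQ hodd h3 hHe hsq1
    hsq2 hρ Dt β ι d₁ hnt M₀ hndiv hw1 Wd ⟨Cd, hCd⟩ hSel, one_mul] at hdvd
  exact (Nat.le_of_dvd (pow_pos two_pos _) hdvd).trans (Nat.pow_le_pow_right two_pos hle)

/-- **`hR` with the exponent left symbolic: `#res⁻¹(Ш(E/K)[2^∞]) ≤ #Ш(E/ℚ)[2^∞] · 2^{ord₂ C(Wd)}`** on U_T's frame (`σ ≠ 1`, any elliptic model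
`Wd ≅ E^(d_K)`; no `w = 1`, no minimality needed) — (R) p749677 + finiteness of `Ш(E/ℚ)[2^∞]` (gk2-p5 g29).  For the LEAD's closer with
`e := padicValNat 2 Wd.tamagawaProduct`.  [cite: Kramer1981, §2 Prop. 3 and Thm. 1] [cite: Kolyvagin1990, Thm. A] -/
theorem natCard_comap_resBaseChange_shaPrimary_le_two_pow_onHabitat (hQ2 : KolyvaginRelationAtTwo)
    (W : WeierstrassCurve ℚ) [W.IsElliptic] [W.IsGloballyMinimal] [NeZero (W.conductorNorm ℤ)] (hcm : ¬ W.HasCM)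
    (hT : Odd W.tamagawaProduct) (v : HeightOneSpectrum (𝓞 ℚ)) (h2v : ((2 : ℕ) : 𝓞 ℚ) ∉ v.asIdeal)
    (hNv : ((W.conductorNorm ℤ : ℕ) : 𝓞 ℚ) ∈ v.asIdeal) (hmult : W.HasMultiplicativeReductionAt v) (hneg : W.Δ < 0)
    (K : Type) [Field K] [NumberField K] (hIQ : IsImaginaryQuadratic K) (hodd : Odd (NumberField.discr K))
    (h3 : NumberField.discr K ≠ -3) (hHe : SatisfiesHeegnerHypothesis (W.conductorNorm ℤ) K)
    (hsq1 : ¬ IsSquare ((NumberField.discr K : ℚ) * -|W.Δ|)) (hsq2 : ¬ IsSquare ((NumberField.discr K : ℚ) * (-(2 * |W.Δ|))))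
    (hρ : ∀ n : ℕ, 0 < n → W.HasSurjectiveModNGaloisRep ((2 : ℤ) ^ n))
    (Dt : ModularParametrizationData W (W.conductorNorm ℤ)) (β : ℤ) (ι : K →+* ℂ) (d₁ : KolyvaginHeegnerData Dt β ι 1) (M₀ : ℕ)
    (hndiv : ¬ ∃ Q : (W.baseChange (ringClassField K ι 1)).toAffine.Point, ((2 ^ (M₀ + 1) : ℕ) : ℤ) • Q = d₁.derivedPoint)
    {σ : K ≃ₐ[ℚ] K} (hσ1 : σ ≠ 1) (Wd : WeierstrassCurve ℚ) [Wd.IsElliptic]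
    (hWd : ∃ C : VariableChange ℚ, C • W.quadraticTwist (NumberField.discr K : ℚ) = Wd) :
    Nat.card (((AddCommGroup.primaryComponent (W.baseChange K).sha 2).map (W.baseChange K).sha.subtype).comap
        (resBaseChange W K)) ≤
      Nat.card (AddCommGroup.primaryComponent W.sha 2) * 2 ^ padicValNat 2 Wd.tamagawaProduct := by
  obtain ⟨Cd, hCd⟩ := hWd
  have hdvd := natCard_comap_resBaseChange_shaPrimary_dvd_two_pow_onFrame W hIQ hσ1 hodd hHe hneg hT Cd hCd
  haveI := PlusDescent.finite_primaryComponent_sha_rat_two_onHabitat hQ2 W hcm hT v h2v hNv hmult hneg K hIQ hodd h3 hHe hsq1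
    hsq2 hρ Dt β ι d₁ M₀ hndiv
  have hpos : 0 < Nat.card (AddCommGroup.primaryComponent W.sha 2) := Nat.card_pos
  exact Nat.le_of_dvd (Nat.mul_pos hpos (pow_pos two_pos _)) hdvd

/-- **The twin side with the exponent left symbolic: `#res′⁻¹(Ш(Wd/K)[2^∞]) ≤ 2^{ord₂ C(Wd)}`** on the live configuration (`w(E) = 1`,
`#Sel₂(Wd) = 2`; `σ ≠ 1`): (R′) p749982 + `#Ш(Wd/ℚ)[2^∞] = 1` (gk2-p5 g29).  [cite: Kramer1981, §2 Prop. 3 and Thm. 1] [cite: Kolyvagin1990, Thm. A] -/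
theorem natCard_comap_resBaseChange_shaPrimary_twin_le_two_pow_onHabitat (hQ2 : KolyvaginRelationAtTwo)
    (W : WeierstrassCurve ℚ) [W.IsElliptic] [W.IsGloballyMinimal] [NeZero (W.conductorNorm ℤ)] (hcm : ¬ W.HasCM)
    (hT : Odd W.tamagawaProduct) (v : HeightOneSpectrum (𝓞 ℚ)) (h2v : ((2 : ℕ) : 𝓞 ℚ) ∉ v.asIdeal)
    (hNv : ((W.conductorNorm ℤ : ℕ) : 𝓞 ℚ) ∈ v.asIdeal) (hmult : W.HasMultiplicativeReductionAt v) (hneg : W.Δ < 0)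
    (K : Type) [Field K] [NumberField K] (hIQ : IsImaginaryQuadratic K) (hodd : Odd (NumberField.discr K))
    (h3 : NumberField.discr K ≠ -3) (hHe : SatisfiesHeegnerHypothesis (W.conductorNorm ℤ) K)
    (hsq1 : ¬ IsSquare ((NumberField.discr K : ℚ) * -|W.Δ|)) (hsq2 : ¬ IsSquare ((NumberField.discr K : ℚ) * (-(2 * |W.Δ|))))
    (hρ : ∀ n : ℕ, 0 < n → W.HasSurjectiveModNGaloisRep ((2 : ℤ) ^ n))
    (Dt : ModularParametrizationData W (W.conductorNorm ℤ)) (β : ℤ) (ι : K →+* ℂ) (d₁ : KolyvaginHeegnerData Dt β ι 1)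
    (hnt : ¬ IsOfFinAddOrder d₁.derivedPoint) (M₀ : ℕ)
    (hndiv : ¬ ∃ Q : (W.baseChange (ringClassField K ι 1)).toAffine.Point, ((2 ^ (M₀ + 1) : ℕ) : ℤ) • Q = d₁.derivedPoint)
    (hw1 : W.rootNumber = 1) {σ : K ≃ₐ[ℚ] K} (hσ1 : σ ≠ 1) (Wd : WeierstrassCurve ℚ) [Wd.IsElliptic]
    (hWd : ∃ C : VariableChange ℚ, C • W.quadraticTwist (NumberField.discr K : ℚ) = Wd)
    (hSel : Nat.card (Wd.selmerGroup 2) = 2) :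
    Nat.card (((AddCommGroup.primaryComponent (Wd.baseChange K).sha 2).map (Wd.baseChange K).sha.subtype).comap
        (resBaseChange Wd K)) ≤ 2 ^ padicValNat 2 Wd.tamagawaProduct := by
  obtain ⟨Cd, hCd⟩ := hWd
  have hdvd := natCard_comap_resBaseChange_shaPrimary_twin_dvd_two_pow_onFrame W hIQ hσ1 hodd hHe hneg hT Cd hCd
  rw [PlusDescent.natCard_primaryComponent_sha_twin_two_eq_one_onHabitat hQ2 W hcm hT v h2v hNv hmult hneg K hIQ hodd h3 hHe hsq1
    hsq2 hρ Dt β ι d₁ hnt M₀ hndiv hw1 Wd ⟨Cd, hCd⟩ hSel, one_mul] at hdvd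
  exact Nat.le_of_dvd (pow_pos two_pos _) hdvd

end Summit.BirchSwinnertonDyer.BirchSwinnertonDyer.Theorems.GenusExact.SelmerDescent

end
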